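import Mathlib
import Literature.Analysis.FluidPDE.Tao2016AveragedNS.BoundedEternalSolutions
import Summits.NavierStokesRegularity.NavierStokesRegularity.Theses.TaoLadderRungTwoBreak

/-!
# Crux `TaoLadderRungTwoBreak.NoSurvivingEternalViscBddOne` (stmt-NavierStokesRegularity-20419), stub (ρ0), DYADIC MEMBER in
# classical form: the ENERGY–FLUX IDENTITY — the energy stranded above bond `n` at the blow-up time equals the lifetime flux
# through bond `n` (minus the flux escaping to infinity)

MODEL lattice ODEs only (the non-negative Katz–Pavlović / Desnianskii–Novikov chain in Tao's critical variables,
`V̇_n = Λ V_{n-1}² − Λ⁻¹ V_n V_{n+1}` on `t < 0`, `Λ = (1+ε₀)^{5/2}`, physical shell energy `e_k = Λ^{-2k}V_k²`, bond flux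
`Π_k = 2Λ^{-2k-1}V_k²V_{k+1}`; tree `…WakeDyadicClassical`); nothing in this file is a statement about the Navier–Stokes equations,
and no stub, crux, rung or summit is proved by it (`--supports stmt-NavierStokesRegularity-20419`).  DEF-FREE (the energies `e` and
fluxes `P` enter as functions with defining hypotheses `he`, `hP`); companion of `…WakeDyadicLifetimeFeedDrain` (identity (I1)) — this
file is identity (I2) of the hand's memo `W1-DSS-identities-memo-leafhand4-g24.md` (evidence on ⟨20419⟩/⟨20205⟩).

* `hasDerivAt_shellEnergy` — `ė_k = Π_{k-1} − Π_k` (the scalar chain's energy transfer, Tao §1.2).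
* `hasDerivAt_blockEnergy` — telescoping: `d/dt Σ_{j<N} e_{n+1+j} = Π_n − Π_{n+N}`.
* `blockEnergy_window` — integrated over a window `[a, b] ⊂ (−∞, 0)`.
* `blockEnergy_terminal` — with terminal values `v_k` (`t ↑ 0`) and lifetime-integrable fluxes:
  `Σ_{j<N} Λ^{-2(n+1+j)} (v_{n+1+j}² − V_{n+1+j}(a)²) = ∫_a^0 Π_n − ∫_a^0 Π_{n+N}` (`a < 0`).
* `blockEnergy_lifetime` — for shells born at rest (`V_k → 0` at `−∞`):
  `Σ_{j<N} Λ^{-2(n+1+j)} v_{n+1+j}² = ∫_{(−∞,0)} Π_n − ∫_{(−∞,0)} Π_{n+N}`.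
* `strandedEnergy_le_flux`, `summable_strandedEnergy` — for non-negative solutions the stranded energy above bond `n` is summable and
  `Σ_{k>n} Λ^{-2k} v_k² ≤ ∫_{(−∞,0)} Π_n` (no tail hypothesis);
* **`hasSum_strandedEnergy`** — if the lifetime flux through bond `n+N` tends to `0` as `N → ∞` (no energy escapes to infinity before
  the blow-up time; automatic on a sub-unitary DSS front), then `Σ_{k>n} Λ^{-2k} v_k² = ∫_{(−∞,0)} 2Λ^{-2n-1}V_n²V_{n+1}`:
  **THE ENERGY STRANDED ABOVE BOND `n` IS THE LIFETIME FLUX THROUGH IT.**  On a DSS front (`v_k = κ^k v₀`, profile `ψ`) this is the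
  profile identity `(I2)  ∫₀^∞ ψ(u)²ψ(κu) du = κΛ/(2(Λ²−κ²))·ψ(0)³⁻¹…` of the memo (geometric left side `hasSum_dss_strandedEnergy`).

HONEST LABEL: elementary real analysis (telescoping, FTC with one-sided limits, improper integrals and series as limits); W1-dyadic,
(ρ0), ⟨20419⟩, ⟨20205⟩ and every NS statement remain OPEN; rung 0.
-/

-- the summit and its single sub-problem share the name (CONVENTIONS §1)
set_option linter.dupNamespace false

namespace Summit.NavierStokesRegularity.NavierStokesRegularity.Theorems.NoSurvivingEternalViscBddOne.EnergyFluxIdentity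

open Filter Topology Set MeasureTheory Finset
open Literature.Analysis.FluidPDE.TaoCascade

variable {ε₀ : ℝ} {V : ℤ → ℝ → ℝ} {e P : ℤ → ℝ → ℝ}

/-! ## The shell energy identity and the telescoping block identity -/

/-- Weight algebra: `Λ^{-2k}·Λ = Λ^{-2(k-1)}·Λ⁻¹`. [folklore] -/
theorem weight_pred {Λ : ℝ} (hΛ : Λ ≠ 0) (k : ℤ) :
    ((Λ ^ k)⁻¹) ^ 2 * Λ = ((Λ ^ (k - 1))⁻¹) ^ 2 * Λ⁻¹ := by
  have hk : Λ ^ k ≠ 0 := zpow_ne_zero k hΛ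
  rw [zpow_sub_one₀ hΛ k]
  field_simp

/-- **Shell energy identity `ė_k = Π_{k-1} − Π_k`** for `e_k = Λ^{-2k}V_k²`, `Π_k = 2Λ^{-2k-1}V_k²V_{k+1}`, on `t < 0`.
[cite: Tao2016AveragedNS, §1.2 (energy transfer at rate `λⁿX_{n+1}X_n²`), §4 Lemma 4.1 (4.8)–(4.10); elementary] -/
theorem hasDerivAt_shellEnergy (hε : 0 < ε₀)
    (hV : ∀ (n : ℤ) (t : ℝ), t < 0 →
      HasDerivAt (V n) (bigLam ε₀ * V (n - 1) t ^ 2 - (bigLam ε₀)⁻¹ * (V n t * V (n + 1) t)) t)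
    (he : ∀ k t, e k t = ((bigLam ε₀ ^ k)⁻¹) ^ 2 * V k t ^ 2)
    (hP : ∀ k t, P k t = 2 * (((bigLam ε₀ ^ k)⁻¹) ^ 2 * (bigLam ε₀)⁻¹) * (V k t ^ 2 * V (k + 1) t))
    (k : ℤ) {t : ℝ} (ht : t < 0) :
    HasDerivAt (e k) (P (k - 1) t - P k t) t := by
  have hΛ : 0 < bigLam ε₀ := bigLam_pos (by linarith)
  have hfun : e k = fun s => ((bigLam ε₀ ^ k)⁻¹) ^ 2 * V k s ^ 2 := funext (he k)
  rw [hfun]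
  have h := ((hV k t ht).pow 2).const_mul (((bigLam ε₀ ^ k)⁻¹) ^ 2)
  have e1 : ((bigLam ε₀ ^ k)⁻¹) ^ 2 *
      (↑(2 : ℕ) * V k t ^ (2 - 1) * (bigLam ε₀ * V (k - 1) t ^ 2 - (bigLam ε₀)⁻¹ * (V k t * V (k + 1) t)))
      = P (k - 1) t - P k t := by
    rw [hP (k - 1) t, hP k t, sub_add_cancel, ← weight_pred hΛ.ne' k]
    push_cast
    ring
  rw [e1] at h
  exact h

/-- **Block energy identity (telescoping)**: `d/dt Σ_{j<N} e_{n+1+j} = Π_n − Π_{n+N}` on `t < 0`.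
[cite: Tao2016AveragedNS, §1.2, §4 Lemma 4.1 (4.8)–(4.10); elementary] -/
theorem hasDerivAt_blockEnergy (hε : 0 < ε₀)
    (hV : ∀ (n : ℤ) (t : ℝ), t < 0 →
      HasDerivAt (V n) (bigLam ε₀ * V (n - 1) t ^ 2 - (bigLam ε₀)⁻¹ * (V n t * V (n + 1) t)) t)
    (he : ∀ k t, e k t = ((bigLam ε₀ ^ k)⁻¹) ^ 2 * V k t ^ 2)
    (hP : ∀ k t, P k t = 2 * (((bigLam ε₀ ^ k)⁻¹) ^ 2 * (bigLam ε₀)⁻¹) * (V k t ^ 2 * V (k + 1) t))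
    (n : ℤ) (N : ℕ) {t : ℝ} (ht : t < 0) :
    HasDerivAt (fun s => ∑ j ∈ range N, e (n + 1 + j) s) (P n t - P (n + N) t) t := by
  have h : HasDerivAt (fun s => ∑ j ∈ range N, e (n + 1 + j) s)
      (∑ j ∈ range N, (P (n + 1 + j - 1) t - P (n + 1 + j) t)) t :=
    HasDerivAt.fun_sum fun j _ => hasDerivAt_shellEnergy hε hV he hP (n + 1 + j) ht
  have htel : ∑ j ∈ range N, (P (n + 1 + j - 1) t - P (n + 1 + j) t) = P n t - P (n + N) t := by
    have e1 : ∀ j : ℕ, P (n + 1 + (j : ℤ) - 1) t - P (n + 1 + (j : ℤ)) t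
        = (fun i : ℕ => P (n + (i : ℤ)) t) j - (fun i : ℕ => P (n + (i : ℤ)) t) (j + 1) := by
      intro j
      simp only
      rw [show n + 1 + (j : ℤ) - 1 = n + (j : ℤ) by ring, show n + 1 + (j : ℤ) = n + ((j + 1 : ℕ) : ℤ) by push_cast; ring]
    rw [Finset.sum_congr rfl fun j _ => e1 j, Finset.sum_range_sub']
    simp
  rw [htel] at h
  exact h

/-! ## Integrated forms -/

/-- Continuity of the fluxes on `t < 0`. [elementary] -/
theorem continuousAt_flux
    (hV : ∀ (n : ℤ) (t : ℝ), t < 0 →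
      HasDerivAt (V n) (bigLam ε₀ * V (n - 1) t ^ 2 - (bigLam ε₀)⁻¹ * (V n t * V (n + 1) t)) t)
    (hP : ∀ k t, P k t = 2 * (((bigLam ε₀ ^ k)⁻¹) ^ 2 * (bigLam ε₀)⁻¹) * (V k t ^ 2 * V (k + 1) t))
    (k : ℤ) {t : ℝ} (ht : t < 0) : ContinuousAt (P k) t := by
  have hfun : P k = fun s => 2 * (((bigLam ε₀ ^ k)⁻¹) ^ 2 * (bigLam ε₀)⁻¹) * (V k s ^ 2 * V (k + 1) s) :=
    funext (hP k)
  rw [hfun]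
  exact (((hV k t ht).continuousAt.pow 2).mul (hV (k + 1) t ht).continuousAt).const_mul _

/-- **Block energy over a window** `[a, b] ⊂ (−∞, 0)`:
`Σ_{j<N} (e_{n+1+j}(b) − e_{n+1+j}(a)) = ∫_a^b Π_n − ∫_a^b Π_{n+N}`.
[cite: Tao2016AveragedNS, §1.2, §4 Lemma 4.1 (4.8)–(4.10); elementary] -/
theorem blockEnergy_window (hε : 0 < ε₀)
    (hV : ∀ (n : ℤ) (t : ℝ), t < 0 →
      HasDerivAt (V n) (bigLam ε₀ * V (n - 1) t ^ 2 - (bigLam ε₀)⁻¹ * (V n t * V (n + 1) t)) t)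
    (he : ∀ k t, e k t = ((bigLam ε₀ ^ k)⁻¹) ^ 2 * V k t ^ 2)
    (hP : ∀ k t, P k t = 2 * (((bigLam ε₀ ^ k)⁻¹) ^ 2 * (bigLam ε₀)⁻¹) * (V k t ^ 2 * V (k + 1) t))
    (n : ℤ) (N : ℕ) {a b : ℝ} (hab : a ≤ b) (hb : b < 0) :
    (∑ j ∈ range N, e (n + 1 + j) b) - (∑ j ∈ range N, e (n + 1 + j) a)
      = (∫ t in a..b, P n t) - ∫ t in a..b, P (n + N) t := by
  have hderiv : ∀ t ∈ uIcc a b, HasDerivAt (fun s => ∑ j ∈ range N, e (n + 1 + j) s) (P n t - P (n + N) t) t := by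
    intro t ht
    rw [uIcc_of_le hab] at ht
    exact hasDerivAt_blockEnergy hε hV he hP n N (lt_of_le_of_lt ht.2 hb)
  have hcontP : ∀ k : ℤ, ContinuousOn (P k) (uIcc a b) := by
    intro k t ht
    rw [uIcc_of_le hab] at ht
    exact (continuousAt_flux hV hP k (lt_of_le_of_lt ht.2 hb)).continuousWithinAt
  have hint : IntervalIntegrable (fun t => P n t - P (n + N) t) volume a b :=
    ((hcontP n).sub (hcontP (n + N))).intervalIntegrable
  have h := intervalIntegral.integral_eq_sub_of_hasDerivAt hderiv hint
  rw [intervalIntegral.integral_sub (hcontP n).intervalIntegrable (hcontP (n + N)).intervalIntegrable] at h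
  linarith

/-- **Block energy up to the terminal time**: with terminal values `v_k` (`t ↑ 0`) and fluxes integrable on `(−∞, 0]`, for `a < 0`:
`Σ_{j<N} Λ^{-2(n+1+j)} (v_{n+1+j}² − V_{n+1+j}(a)²) = ∫_a^0 Π_n − ∫_a^0 Π_{n+N}`.
[cite: Tao2016AveragedNS, §1.2, §4 Lemma 4.1 (4.8)–(4.10), §6.4; elementary] -/
theorem blockEnergy_terminal (hε : 0 < ε₀)
    (hV : ∀ (n : ℤ) (t : ℝ), t < 0 →
      HasDerivAt (V n) (bigLam ε₀ * V (n - 1) t ^ 2 - (bigLam ε₀)⁻¹ * (V n t * V (n + 1) t)) t)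
    (hP : ∀ k t, P k t = 2 * (((bigLam ε₀ ^ k)⁻¹) ^ 2 * (bigLam ε₀)⁻¹) * (V k t ^ 2 * V (k + 1) t))
    {v : ℤ → ℝ} (hv : ∀ n : ℤ, Tendsto (V n) (𝓝[<] 0) (𝓝 (v n)))
    (hPint : ∀ k : ℤ, IntegrableOn (P k) (Iic 0))
    (n : ℤ) (N : ℕ) {a : ℝ} (ha : a < 0) :
    (∑ j ∈ range N, ((bigLam ε₀ ^ (n + 1 + j))⁻¹) ^ 2 * (v (n + 1 + j) ^ 2 - V (n + 1 + j) a ^ 2))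
      = (∫ t in a..(0 : ℝ), P n t) - ∫ t in a..(0 : ℝ), P (n + N) t := by
  set e : ℤ → ℝ → ℝ := fun k t => ((bigLam ε₀ ^ k)⁻¹) ^ 2 * V k t ^ 2 with hedef
  have he : ∀ k t, e k t = ((bigLam ε₀ ^ k)⁻¹) ^ 2 * V k t ^ 2 := fun k t => rfl
  -- FTC on `(a, 0)` with the one-sided terminal limit of the block energy
  have hderiv : ∀ t ∈ Ioo a 0, HasDerivAt (fun s => ∑ j ∈ range N, e (n + 1 + j) s) (P n t - P (n + N) t) t :=
    fun t ht => hasDerivAt_blockEnergy hε hV he hP n N ht.2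
  have hsub : uIcc a 0 ⊆ Iic 0 := by rw [uIcc_of_le ha.le]; exact Icc_subset_Iic_self
  have hintn : IntervalIntegrable (P n) volume a 0 := ((hPint n).mono_set hsub).intervalIntegrable
  have hintN : IntervalIntegrable (P (n + N)) volume a 0 := ((hPint (n + N)).mono_set hsub).intervalIntegrable
  have hint : IntervalIntegrable (fun t => P n t - P (n + N) t) volume a 0 := hintn.sub hintN
  have hleft : Tendsto (fun s => ∑ j ∈ range N, e (n + 1 + j) s) (𝓝[>] a)
      (𝓝 (∑ j ∈ range N, e (n + 1 + j) a)) :=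
    ((hasDerivAt_blockEnergy hε hV he hP n N ha).continuousAt.tendsto).mono_left nhdsWithin_le_nhds
  have hright : Tendsto (fun s => ∑ j ∈ range N, e (n + 1 + j) s) (𝓝[<] 0)
      (𝓝 (∑ j ∈ range N, ((bigLam ε₀ ^ (n + 1 + j))⁻¹) ^ 2 * v (n + 1 + j) ^ 2)) := by
    refine tendsto_finsetSum _ fun j _ => ?_
    exact ((hv (n + 1 + j)).pow 2).const_mul _
  have h := intervalIntegral.integral_eq_sub_of_hasDerivAt_of_tendsto ha hderiv hint hleft hright
  rw [intervalIntegral.integral_sub hintn hintN] at h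
  rw [h, ← Finset.sum_sub_distrib]
  refine Finset.sum_congr rfl fun j _ => ?_
  ring

/-- **Block energy over the whole lifetime**: for shells born at rest (`V_k → 0` as `t → −∞`),
`Σ_{j<N} Λ^{-2(n+1+j)} v_{n+1+j}² = ∫_{(−∞,0)} Π_n − ∫_{(−∞,0)} Π_{n+N}`.
[cite: Tao2016AveragedNS, §1.2, §4 Lemma 4.1 (4.8)–(4.10), §6.4; elementary] -/
theorem blockEnergy_lifetime (hε : 0 < ε₀)
    (hV : ∀ (n : ℤ) (t : ℝ), t < 0 →
      HasDerivAt (V n) (bigLam ε₀ * V (n - 1) t ^ 2 - (bigLam ε₀)⁻¹ * (V n t * V (n + 1) t)) t)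
    (hP : ∀ k t, P k t = 2 * (((bigLam ε₀ ^ k)⁻¹) ^ 2 * (bigLam ε₀)⁻¹) * (V k t ^ 2 * V (k + 1) t))
    {v : ℤ → ℝ} (hv : ∀ n : ℤ, Tendsto (V n) (𝓝[<] 0) (𝓝 (v n)))
    (hpast : ∀ k : ℤ, Tendsto (V k) atBot (𝓝 0))
    (hPint : ∀ k : ℤ, IntegrableOn (P k) (Iic 0))
    (n : ℤ) (N : ℕ) :
    (∑ j ∈ range N, ((bigLam ε₀ ^ (n + 1 + j))⁻¹) ^ 2 * v (n + 1 + j) ^ 2)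
      = (∫ t in Iio 0, P n t) - ∫ t in Iio 0, P (n + N) t := by
  -- both sides are limits, as `a → −∞`, of the two sides of `blockEnergy_terminal`
  have hlimR : Tendsto (fun a : ℝ => (∫ t in a..(0 : ℝ), P n t) - ∫ t in a..(0 : ℝ), P (n + N) t) atBot
      (𝓝 ((∫ t in Iic 0, P n t) - ∫ t in Iic 0, P (n + N) t)) :=
    (MeasureTheory.intervalIntegral_tendsto_integral_Iic 0 (hPint n) tendsto_id).sub
      (MeasureTheory.intervalIntegral_tendsto_integral_Iic 0 (hPint (n + N)) tendsto_id)
  have hlimL : Tendsto (fun a : ℝ =>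
      ∑ j ∈ range N, ((bigLam ε₀ ^ (n + 1 + j))⁻¹) ^ 2 * (v (n + 1 + j) ^ 2 - V (n + 1 + j) a ^ 2)) atBot
      (𝓝 (∑ j ∈ range N, ((bigLam ε₀ ^ (n + 1 + j))⁻¹) ^ 2 * (v (n + 1 + j) ^ 2 - 0 ^ 2))) := by
    refine tendsto_finsetSum _ fun j _ => ?_
    exact (tendsto_const_nhds.sub ((hpast (n + 1 + j)).pow 2)).const_mul _
  have hlimL' : Tendsto (fun a : ℝ =>
      ∑ j ∈ range N, ((bigLam ε₀ ^ (n + 1 + j))⁻¹) ^ 2 * (v (n + 1 + j) ^ 2 - V (n + 1 + j) a ^ 2)) atBot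
      (𝓝 ((∫ t in Iic 0, P n t) - ∫ t in Iic 0, P (n + N) t)) := by
    refine hlimR.congr' ?_
    filter_upwards [eventually_lt_atBot (0 : ℝ)] with a ha
    exact (blockEnergy_terminal hε hV hP hv hPint n N ha).symm
  have heq := tendsto_nhds_unique hlimL hlimL'
  simp only [zero_pow two_ne_zero, sub_zero] at heq
  rw [heq, integral_Iic_eq_integral_Iio, integral_Iic_eq_integral_Iio]

/-! ## The stranded energy above bond `n` -/

/-- Lifetime fluxes of a non-negative solution are non-negative. [elementary] -/
theorem lifetimeFlux_nonneg (hε : 0 < ε₀)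
    (hpos : ∀ (n : ℤ) (t : ℝ), t < 0 → 0 ≤ V n t)
    (hP : ∀ k t, P k t = 2 * (((bigLam ε₀ ^ k)⁻¹) ^ 2 * (bigLam ε₀)⁻¹) * (V k t ^ 2 * V (k + 1) t))
    (k : ℤ) : 0 ≤ ∫ t in Iio 0, P k t := by
  have hΛ : 0 < bigLam ε₀ := bigLam_pos (by linarith)
  refine setIntegral_nonneg measurableSet_Iio fun t ht => ?_
  rw [hP k t]
  have h1 : 0 ≤ V (k + 1) t := hpos (k + 1) t ht
  have h2 : 0 ≤ ((bigLam ε₀ ^ k)⁻¹) ^ 2 * (bigLam ε₀)⁻¹ := mul_nonneg (sq_nonneg _) (inv_nonneg.2 hΛ.le)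
  have h3 : 0 ≤ V k t ^ 2 * V (k + 1) t := mul_nonneg (sq_nonneg _) h1
  positivity

/-- **Partial stranded energies are bounded by the lifetime flux**: for a non-negative solution,
`Σ_{j<N} Λ^{-2(n+1+j)} v_{n+1+j}² ≤ ∫_{(−∞,0)} Π_n` for every `N`.
[cite: Tao2016AveragedNS, §1.2, §4 Lemma 4.1 (4.8)–(4.10), §6.4; elementary] -/
theorem sum_strandedEnergy_le_flux (hε : 0 < ε₀)
    (hV : ∀ (n : ℤ) (t : ℝ), t < 0 →
      HasDerivAt (V n) (bigLam ε₀ * V (n - 1) t ^ 2 - (bigLam ε₀)⁻¹ * (V n t * V (n + 1) t)) t)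
    (hpos : ∀ (n : ℤ) (t : ℝ), t < 0 → 0 ≤ V n t)
    (hP : ∀ k t, P k t = 2 * (((bigLam ε₀ ^ k)⁻¹) ^ 2 * (bigLam ε₀)⁻¹) * (V k t ^ 2 * V (k + 1) t))
    {v : ℤ → ℝ} (hv : ∀ n : ℤ, Tendsto (V n) (𝓝[<] 0) (𝓝 (v n)))
    (hpast : ∀ k : ℤ, Tendsto (V k) atBot (𝓝 0))
    (hPint : ∀ k : ℤ, IntegrableOn (P k) (Iic 0))
    (n : ℤ) (N : ℕ) :
    (∑ j ∈ range N, ((bigLam ε₀ ^ (n + 1 + j))⁻¹) ^ 2 * v (n + 1 + j) ^ 2) ≤ ∫ t in Iio 0, P n t := by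
  rw [blockEnergy_lifetime hε hV hP hv hpast hPint n N]
  have h := lifetimeFlux_nonneg hε hpos hP (n + N)
  linarith

/-- **The stranded energy above bond `n` is summable** (non-negative solution, lifetime-integrable fluxes).
[cite: Tao2016AveragedNS, §1.2, §4, §6.4; elementary] -/
theorem summable_strandedEnergy (hε : 0 < ε₀)
    (hV : ∀ (n : ℤ) (t : ℝ), t < 0 →
      HasDerivAt (V n) (bigLam ε₀ * V (n - 1) t ^ 2 - (bigLam ε₀)⁻¹ * (V n t * V (n + 1) t)) t)
    (hpos : ∀ (n : ℤ) (t : ℝ), t < 0 → 0 ≤ V n t)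
    (hP : ∀ k t, P k t = 2 * (((bigLam ε₀ ^ k)⁻¹) ^ 2 * (bigLam ε₀)⁻¹) * (V k t ^ 2 * V (k + 1) t))
    {v : ℤ → ℝ} (hv : ∀ n : ℤ, Tendsto (V n) (𝓝[<] 0) (𝓝 (v n)))
    (hpast : ∀ k : ℤ, Tendsto (V k) atBot (𝓝 0))
    (hPint : ∀ k : ℤ, IntegrableOn (P k) (Iic 0)) (n : ℤ) :
    Summable fun j : ℕ => ((bigLam ε₀ ^ (n + 1 + j))⁻¹) ^ 2 * v (n + 1 + j) ^ 2 := by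
  refine summable_of_sum_range_le (c := ∫ t in Iio 0, P n t) (fun _ => ?_) fun N => ?_
  · exact mul_nonneg (sq_nonneg _) (sq_nonneg _)
  · exact sum_strandedEnergy_le_flux hε hV hpos hP hv hpast hPint n N

/-- **Stranded energy ≤ lifetime flux**: `Σ_{k>n} Λ^{-2k} v_k² ≤ ∫_{(−∞,0)} 2Λ^{-2n-1}V_n²V_{n+1}` (no hypothesis on the flux at
infinity).  [cite: Tao2016AveragedNS, §1.2, §4, §6.4; elementary] -/
theorem strandedEnergy_le_flux (hε : 0 < ε₀)
    (hV : ∀ (n : ℤ) (t : ℝ), t < 0 →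
      HasDerivAt (V n) (bigLam ε₀ * V (n - 1) t ^ 2 - (bigLam ε₀)⁻¹ * (V n t * V (n + 1) t)) t)
    (hpos : ∀ (n : ℤ) (t : ℝ), t < 0 → 0 ≤ V n t)
    (hP : ∀ k t, P k t = 2 * (((bigLam ε₀ ^ k)⁻¹) ^ 2 * (bigLam ε₀)⁻¹) * (V k t ^ 2 * V (k + 1) t))
    {v : ℤ → ℝ} (hv : ∀ n : ℤ, Tendsto (V n) (𝓝[<] 0) (𝓝 (v n)))
    (hpast : ∀ k : ℤ, Tendsto (V k) atBot (𝓝 0))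
    (hPint : ∀ k : ℤ, IntegrableOn (P k) (Iic 0)) (n : ℤ) :
    (∑' j : ℕ, ((bigLam ε₀ ^ (n + 1 + j))⁻¹) ^ 2 * v (n + 1 + j) ^ 2) ≤ ∫ t in Iio 0, P n t :=
  Real.tsum_le_of_sum_range_le (fun _ => mul_nonneg (sq_nonneg _) (sq_nonneg _))
    fun N => sum_strandedEnergy_le_flux hε hV hpos hP hv hpast hPint n N

/-- **THE ENERGY–FLUX IDENTITY.**  If, in addition, the lifetime flux through bond `n+N` tends to zero as `N → ∞` (no energy
escapes to infinitely high shells before the blow-up time), then the energy stranded above bond `n` IS the lifetime flux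
through bond `n`: `Σ_{k>n} Λ^{-2k} v_k² = ∫_{(−∞,0)} 2Λ^{-2n-1}V_n²V_{n+1}`.
[cite: Tao2016AveragedNS, §1.2 (energy transfer equations), §4 Lemma 4.1 (4.8)–(4.10), §6.4; elementary] -/
theorem hasSum_strandedEnergy (hε : 0 < ε₀)
    (hV : ∀ (n : ℤ) (t : ℝ), t < 0 →
      HasDerivAt (V n) (bigLam ε₀ * V (n - 1) t ^ 2 - (bigLam ε₀)⁻¹ * (V n t * V (n + 1) t)) t)
    (hP : ∀ k t, P k t = 2 * (((bigLam ε₀ ^ k)⁻¹) ^ 2 * (bigLam ε₀)⁻¹) * (V k t ^ 2 * V (k + 1) t))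
    {v : ℤ → ℝ} (hv : ∀ n : ℤ, Tendsto (V n) (𝓝[<] 0) (𝓝 (v n)))
    (hpast : ∀ k : ℤ, Tendsto (V k) atBot (𝓝 0))
    (hPint : ∀ k : ℤ, IntegrableOn (P k) (Iic 0)) (n : ℤ)
    (htail : Tendsto (fun N : ℕ => ∫ t in Iio 0, P (n + N) t) atTop (𝓝 0)) :
    HasSum (fun j : ℕ => ((bigLam ε₀ ^ (n + 1 + j))⁻¹) ^ 2 * v (n + 1 + j) ^ 2) (∫ t in Iio 0, P n t) := by
  rw [hasSum_iff_tendsto_nat_of_nonneg (fun _ => mul_nonneg (sq_nonneg _) (sq_nonneg _))]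
  have h : Tendsto (fun N : ℕ => (∫ t in Iio 0, P n t) - ∫ t in Iio 0, P (n + N) t) atTop
      (𝓝 ((∫ t in Iio 0, P n t) - 0)) := tendsto_const_nhds.sub htail
  rw [sub_zero] at h
  refine h.congr fun N => ?_
  exact (blockEnergy_lifetime hε hV hP hv hpast hPint n N).symm

/-! ## DSS reading: the geometric stranded energy of a front -/

/-- On a DSS front (`v_k = κ^k v_0`-type geometric terminal profile, `0 < κ < Λ`) the stranded energy above bond `n` is the
geometric series `Σ_{j} Λ^{-2(n+1+j)} (κ^{n+1+j} c)² = (κ/Λ)^{2(n+1)} c² / (1 − (κ/Λ)²)`; with `hasSum_strandedEnergy` this is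
the profile identity (I2) of the memo.  Stated for a natural base shell `n ≥ 0` to stay with natural powers.
[cite: Tao2016AveragedNS, §1.2, §4, §6.4; elementary (geometric series)] -/
theorem hasSum_dss_strandedEnergy {Λ κ c : ℝ} (hΛ : 0 < Λ) (hκ : 0 ≤ κ) (hκΛ : κ < Λ) (n : ℕ) :
    HasSum (fun j : ℕ => ((Λ ^ (n + 1 + j))⁻¹) ^ 2 * (κ ^ (n + 1 + j) * c) ^ 2)
      ((κ / Λ) ^ (2 * (n + 1)) * c ^ 2 / (1 - (κ / Λ) ^ 2)) := by
  have hr : 0 ≤ (κ / Λ) ^ 2 := sq_nonneg _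
  have hr1 : (κ / Λ) ^ 2 < 1 := by
    have : κ / Λ < 1 := (div_lt_one hΛ).2 hκΛ
    have h0 : 0 ≤ κ / Λ := div_nonneg hκ hΛ.le
    nlinarith
  have hgeo := hasSum_geometric_of_lt_one hr hr1
  have h := hgeo.mul_left ((κ / Λ) ^ (2 * (n + 1)) * c ^ 2)
  have hΛne : Λ ≠ 0 := hΛ.ne'
  have e : ∀ j : ℕ, ((Λ ^ (n + 1 + j))⁻¹) ^ 2 * (κ ^ (n + 1 + j) * c) ^ 2
      = (κ / Λ) ^ (2 * (n + 1)) * c ^ 2 * ((κ / Λ) ^ 2) ^ j := by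
    intro j
    rw [show ((Λ ^ (n + 1 + j))⁻¹) ^ 2 * (κ ^ (n + 1 + j) * c) ^ 2 = ((κ / Λ) ^ (n + 1 + j)) ^ 2 * c ^ 2 by
      rw [div_pow]; ring]
    ring
  rw [show (κ / Λ) ^ (2 * (n + 1)) * c ^ 2 / (1 - (κ / Λ) ^ 2)
      = (κ / Λ) ^ (2 * (n + 1)) * c ^ 2 * (1 - (κ / Λ) ^ 2)⁻¹ from div_eq_mul_inv _ _,
    show (fun j : ℕ => ((Λ ^ (n + 1 + j))⁻¹) ^ 2 * (κ ^ (n + 1 + j) * c) ^ 2)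
      = fun j : ℕ => (κ / Λ) ^ (2 * (n + 1)) * c ^ 2 * ((κ / Λ) ^ 2) ^ j from funext e]
  exact h

end Summit.NavierStokesRegularity.NavierStokesRegularity.Theorems.NoSurvivingEternalViscBddOne.EnergyFluxIdentity
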